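import Summits.QuantumFields.YangMills.Theorems.UnitScaleTiltProp7KinvVariationalRows
import Summits.QuantumFields.YangMills.Theorems.UnitScaleTiltProp7OneFormGarding
import Summits.QuantumFields.YangMills.Theorems.UnitScaleTiltProp7OneFormAgmonLocal
import HarnessLib

/-!
# Route `UnitScaleTilt`, crux K1 «MinimiserStabilityRegPr» (stmt-QuantumFields-19200), EX rows `h137kπ` ∕ `h137kΔ` ∕ `hCk` — **K-STOREY BRICK (K1b-b) (px12 g16, LOCATE-K137 529f36ee
# road (K1), the KNIT over ✓p767189 (K1a)): THE `Δ_a`-ENERGY OF AN INTERPOLANT FROM ITS KATO ROWS, AND THE K-FREE BOUND OF `K⁻¹ = (Q_kGQ_k*)⁻¹` ON `RegPr`** — for a linear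
# `E : (coarse bond fields) → (fine bond fields)` with (a) `‖Q_k(U₀)(Ec) − c‖ ≤ θ‖c‖`, (s1) `‖Ec‖ ≤ C₁‖c‖`, (s2) Kato energy `Σ_μ‖D_{U₀}(Ec)_μ‖² ≤ C_D‖c‖²` and a slot letter
# `re⟪v,(Δx − Δ^η)v⟫ ≤ C_s‖v‖²`: **`re⟪Ec, Δ_a(U₀)(Ec)⟫ ≤ (C_D + (C_loc(ε₀) + C_s)·C₁² + a(1+θ)²)·‖c‖²`**, `C_loc(ε₀) = 32√2·ε₀·(3·6³)` (px21 ✓`abs_re_inner_local_le`), by the chair's form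
# identity ✓`Prop7OneFormGarding.inner_laplaceA_eq` with the complementary-projector term DROPPED (it is `−‖(1−R_S)D*v‖² ≤ 0`); hence, for `θ ≤ ½`, ✓`norm_KinvT_le_of_approxRightInverse`:
# **`‖KinvT … Δx U₀ ω‖ ≤ 4C₀‖ω‖` and `(4C₀)⁻¹‖ω‖² ≤ re⟪ω, Kω⟫`** on `PosOnto ∧ RegPr`, and the `DeltaEtaSlot` edition (`C_s = 0`).

Cell `ym3-torus` (HUMAN RULING D-0037: SU(2) YM₃ on T³ is ladder rung R3 — NOT d = 4, NOT infinite volume, NOT a mass gap, NOT Clay).  Width seat `ym3-torus-px12` gen 16; bus 08:5xZ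
«(K1b) SPLIT: (K1b-a) px13 g15 (the TRANSPORTED interpolant `E` with rows (a)(s1)(s2) — GO given), (K1b-b) px12 (this knit)».  THEOREMS ONLY (0 `def`, 0 `sorry`);
`--supports stmt-QuantumFields-19200 --as helper`, count-neutral.  HONEST LABEL: bookkeeping over landed identities; the interpolant `E` and its three rows are HYPOTHESES (px13's
pen); nothing of (3.132)'s kernel decay, `h137kπ`, `h137kΔ`, `hCk`, EX or 19200 is proved here.

THE MATHEMATICS.  ✓`inner_laplaceA_eq` (every `U₀`, slot, `a`, `X`; `v := toL2 X`):
`⟪v, Δ_a v⟫ = Σ_μ‖D_{U₀}(toL2S X_μ)‖² + ⟪v, toL2(η⁻²(Δ′₁ − 𝒦)X)⟫ + ⟪v,(Δx − Δ^η)v⟫ − ‖D*v − R_SD*v‖² + a‖Q_kv‖²`.  Take real parts, drop the negative square, bound the local form by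
✓`abs_re_inner_local_le` (`C_loc‖v‖²` on `RegPr`), the slot by its letter, `‖v‖ ≤ C₁‖c‖`, and `‖Q_kv‖ ≤ ‖Q_kv − c‖ + ‖c‖ ≤ (1+θ)‖c‖`.

WHAT IS PROVED (ns `Summit.QuantumFields.YangMills.Theorems.Prop7KinvBoundOfInterpolant`).
* §1 ★★ `re_inner_laplaceA_le_of_rows` — the energy upper bound for ONE field `v = toL2 X` from its Kato energy, `RegPr`, the slot letter (no interpolant yet).
* §2 ★★★ `energy_interpolant_le` — `re⟪Ec, Δ_a(Ec)⟫ ≤ C₀‖c‖²` with `C₀ := C_D + (C_loc + C_s)C₁² + a(1+θ)²` from (a)(s1)(s2) + slot letter.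
* §3 ★★★ `norm_KinvT_le_of_interpolant_rows` — `‖K⁻¹ω‖ ≤ 4C₀‖ω‖ ∧ (4C₀)⁻¹‖ω‖² ≤ re⟪ω, Q_kGQ_k†ω⟫` on `PosOnto`, `Δx` symmetric, `RegPr`, `θ ≤ ½`; ★★ `norm_KinvT_DeltaEtaSlot_le_of_interpolant_rows`
  (the slot of record `DeltaEtaSlot`, `C_s = 0`).

References: T. Bałaban, CMP **99** (1985) 389–434 [Balaban1985BackgroundPropagators] ((3.26) p.395, (3.126)–(3.127) pp.420–421, (3.132) p.422); CMP **102** (1985) 277–309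
[Balaban1985Variational] ((134)–(136) p.298, (45)–(46) p.285); CMP **95** (1984) 17–40 [Balaban1984PropagatorsI] ((1.47)–(1.50) p.26).
-/

set_option autoImplicit false

noncomputable section

open scoped BigOperators InnerProductSpace ComplexConjugate

namespace Summit.QuantumFields.YangMills.Theorems.Prop7KinvBoundOfInterpolant

open Literature.MathematicalPhysics.QuantumFieldTheory.Balaban1983to89
open Literature.MathematicalPhysics.QuantumFieldTheory.Balaban1983to89.T3ContinuumYM3Torus
open T3SectALandauChart (eta eta_pos bgUnits formComp)
open T3PrintedRegularMinimiser (RegPr)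
open B9TorusCalculus (torusT)
open B9Eq310Hermitian (deltaPrimeOp)
open B11Eq135Weitzenbock (curvOp)
open B11Eq103H1Complex (SiteL2K BondL2K)
open B9Eq311L2Pairing (WL2)
open Summit.QuantumFields.YangMills.Theorems.Prop7SectET3Transport (periodsT3)
open Summit.QuantumFields.YangMills.Theorems.Prop7SectET3HilbertLetters (W₂ toL2 toL2S DL2 DstarL2)
open Summit.QuantumFields.YangMills.Theorems.Prop7SectET3WilsonHessian (DeltaEta DeltaEtaSlot)
open Summit.QuantumFields.YangMills.Theorems.Prop7SectET3GaugeProjector (RS)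
open Summit.QuantumFields.YangMills.Theorems.Prop7SectET3CurvedPropagators (Qk laplaceA PosOnto GT KinvT)
open Summit.QuantumFields.YangMills.Theorems.Prop7OneFormGarding (inner_laplaceA_eq)
open Summit.QuantumFields.YangMills.Theorems.Prop7OneFormAgmonLocal (abs_re_inner_local_le)
open Summit.QuantumFields.YangMills.Theorems.Prop7KinvVariationalRows (norm_KinvT_le_of_approxRightInverse)

variable {F : T3Family} {n K : ℕ} {h : n ≤ K} {c₀ cB a : ℝ} [Fact (0 < c₀)] [Fact (0 < cB)]
  {Δx : GaugeField (F.P K) 0 (Matrix.specialUnitaryGroup (Fin 2) ℂ) → (BondL2K ℂ 3 (periodsT3 F K) c₀ W₂ →ₗ[ℂ] BondL2K ℂ 3 (periodsT3 F K) c₀ W₂)}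
  {U₀ : GaugeField (F.P K) 0 (Matrix.specialUnitaryGroup (Fin 2) ℂ)}

/-! ## §1 The energy of one field from its Kato rows -/

/-- ★★ **THE `Δ_a`-ENERGY OF A BOND FIELD FROM ITS KATO ENERGY** (every slot `Δx`, `a ≥ 0`, on `RegPr F n K ε₀ U₀`): with `v := toL2 X`,
`re⟪v, Δ_a v⟫ ≤ Σ_μ‖D_{U₀}(toL2S X_μ)‖² + C_loc(ε₀)·‖v‖² + re⟪v,(Δx − Δ^η)v⟫ + a‖Q_kv‖²`, `C_loc(ε₀) = 32√2·ε₀·(d·6^d)` — ✓`inner_laplaceA_eq` with the complementary-projector square dropped and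
px21's ✓`abs_re_inner_local_le`. [cite: Balaban1985Variational, (134)–(136) p.298; Balaban1985BackgroundPropagators, (3.26) p.395] -/
theorem re_inner_laplaceA_le_of_rows {ε₀ : ℝ} (hε₀ : 0 ≤ ε₀) (hreg : RegPr F n K ε₀ U₀) (X : PBond (F.P K) 0 → Matrix (Fin 2) (Fin 2) ℂ) :
    RCLike.re ⟪toL2 F K c₀ X, laplaceA F n K h c₀ cB a Δx U₀ (toL2 F K c₀ X)⟫_ℂ
      ≤ (∑ μ : Fin (F.P K).d, ‖DL2 F n K c₀ U₀ (toL2S F K c₀ (formComp X μ))‖ ^ 2)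
        + 32 * Real.sqrt 2 * ε₀ * (((F.P K).d : ℝ) * (2 * 3) ^ (F.P K).d) * ‖toL2 F K c₀ X‖ ^ 2
        + RCLike.re ⟪toL2 F K c₀ X, (Δx U₀ - (DeltaEta F n K c₀ U₀ : BondL2K ℂ 3 (periodsT3 F K) c₀ W₂ →ₗ[ℂ] BondL2K ℂ 3 (periodsT3 F K) c₀ W₂)) (toL2 F K c₀ X)⟫_ℂ
        + a * ‖Qk F n K h c₀ cB U₀ (toL2 F K c₀ X)‖ ^ 2 := by
  have hid := congrArg RCLike.re (inner_laplaceA_eq (h := h) (cB := cB) (a := a) (Δx := Δx) U₀ X)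
  simp only [map_add, map_sub] at hid
  have hsum : RCLike.re (∑ μ : Fin (F.P K).d, ((‖DL2 F n K c₀ U₀ (toL2S F K c₀ (formComp X μ))‖ : ℝ) : ℂ) ^ 2)
      = ∑ μ : Fin (F.P K).d, ‖DL2 F n K c₀ U₀ (toL2S F K c₀ (formComp X μ))‖ ^ 2 := by
    rw [map_sum]
    refine Finset.sum_congr rfl fun μ _ => ?_
    norm_cast
  have hre1 : RCLike.re ((((‖DstarL2 F n K c₀ U₀ (toL2 F K c₀ X) - RS F n K h c₀ cB U₀ (DstarL2 F n K c₀ U₀ (toL2 F K c₀ X))‖ : ℝ) : ℂ) ^ 2))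
      = ‖DstarL2 F n K c₀ U₀ (toL2 F K c₀ X) - RS F n K h c₀ cB U₀ (DstarL2 F n K c₀ U₀ (toL2 F K c₀ X))‖ ^ 2 := by norm_cast
  have hre2 : RCLike.re ((((a : ℝ) : ℂ)) * (((‖Qk F n K h c₀ cB U₀ (toL2 F K c₀ X)‖ : ℝ) : ℂ) ^ 2)) = a * ‖Qk F n K h c₀ cB U₀ (toL2 F K c₀ X)‖ ^ 2 := by
    norm_cast
  rw [hsum, hre1, hre2] at hid
  have hl : RCLike.re ⟪toL2 F K c₀ X, toL2 F K c₀ (fun b : PBond (F.P K) 0 => (eta F n K)⁻¹ • (eta F n K)⁻¹ •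
        (deltaPrimeOp (torusT (F.P K) 0) (fun μ x => bgUnits F K U₀ ⟨x, μ⟩) 1 (formComp X) b.dir b.src
          - curvOp (torusT (F.P K) 0) (fun μ x => bgUnits F K U₀ ⟨x, μ⟩) (formComp X) b.dir b.src))⟫_ℂ
      ≤ 32 * Real.sqrt 2 * ε₀ * (((F.P K).d : ℝ) * (2 * 3) ^ (F.P K).d) * ‖toL2 F K c₀ X‖ ^ 2 :=
    (abs_le.mp (abs_re_inner_local_le F c₀ U₀ hε₀ hreg X)).2
  have hp : 0 ≤ ‖DstarL2 F n K c₀ U₀ (toL2 F K c₀ X) - RS F n K h c₀ cB U₀ (DstarL2 F n K c₀ U₀ (toL2 F K c₀ X))‖ ^ 2 := sq_nonneg _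
  rw [hid]
  linarith

/-! ## §2 The energy of an interpolant from its three rows -/

/-- ★★★ **THE `Δ_a`-ENERGY OF AN INTERPOLANT FROM ITS ROWS**: a linear `E` with (a) `‖Q_k(Ec) − c‖ ≤ θ‖c‖` (`0 ≤ θ`), (s1) `‖Ec‖ ≤ C₁‖c‖`, (s2) `Σ_μ‖D_{U₀}(toL2S (Ec)_μ)‖² ≤ C_D‖c‖²`, a slot
letter `re⟪v,(Δx − Δ^η)v⟫ ≤ C_s‖v‖²` (`0 ≤ C_s`), on `RegPr F n K ε₀ U₀` (`0 ≤ ε₀`, `0 ≤ a`; `θ` of any sign — only `‖Q_k(Ec)‖ ≤ (1+θ)‖c‖` is used, squared):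
`re⟪Ec, Δ_a(Ec)⟫ ≤ (C_D + (C_loc(ε₀) + C_s)·C₁² + a(1+θ)²)·‖c‖²`. [cite: Balaban1985Variational, (134)–(136) p.298; Balaban1985BackgroundPropagators, (3.26) p.395, (3.132) p.422] -/
theorem energy_interpolant_le {ε₀ : ℝ} (hε₀ : 0 ≤ ε₀) (hreg : RegPr F n K ε₀ U₀) (ha : 0 ≤ a)
    (E : WL2 ℂ (fun _ : PBond (F.P n) 0 => cB) W₂ →ₗ[ℂ] BondL2K ℂ 3 (periodsT3 F K) c₀ W₂) {θ C₁ CD Cs : ℝ} (hCs : 0 ≤ Cs)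
    (hQE : ∀ c, ‖Qk F n K h c₀ cB U₀ (E c) - c‖ ≤ θ * ‖c‖)
    (hE₁ : ∀ c, ‖E c‖ ≤ C₁ * ‖c‖)
    (hED : ∀ c, ∑ μ : Fin (F.P K).d, ‖DL2 F n K c₀ U₀ (toL2S F K c₀ (formComp ((toL2 F K c₀).symm (E c)) μ))‖ ^ 2 ≤ CD * ‖c‖ ^ 2)
    (hslot : ∀ v, RCLike.re ⟪v, (Δx U₀ - (DeltaEta F n K c₀ U₀ : BondL2K ℂ 3 (periodsT3 F K) c₀ W₂ →ₗ[ℂ] BondL2K ℂ 3 (periodsT3 F K) c₀ W₂)) v⟫_ℂ ≤ Cs * ‖v‖ ^ 2)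
    (c : WL2 ℂ (fun _ : PBond (F.P n) 0 => cB) W₂) :
    RCLike.re ⟪E c, laplaceA F n K h c₀ cB a Δx U₀ (E c)⟫_ℂ
      ≤ (CD + (32 * Real.sqrt 2 * ε₀ * (((F.P K).d : ℝ) * (2 * 3) ^ (F.P K).d) + Cs) * C₁ ^ 2 + a * (1 + θ) ^ 2) * ‖c‖ ^ 2 := by
  set X : PBond (F.P K) 0 → Matrix (Fin 2) (Fin 2) ℂ := (toL2 F K c₀).symm (E c) with hX
  have hv : toL2 F K c₀ X = E c := by rw [hX, LinearEquiv.apply_symm_apply]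
  have h1 := re_inner_laplaceA_le_of_rows (h := h) (cB := cB) (a := a) (Δx := Δx) hε₀ hreg X
  rw [hv] at h1
  set Cloc : ℝ := 32 * Real.sqrt 2 * ε₀ * (((F.P K).d : ℝ) * (2 * 3) ^ (F.P K).d) with hCloc
  have hCloc0 : 0 ≤ Cloc := by rw [hCloc]; positivity
  -- the four pieces
  have hD := hED c
  have hv2 : ‖E c‖ ^ 2 ≤ C₁ ^ 2 * ‖c‖ ^ 2 := by
    have := hE₁ c
    have h0 : 0 ≤ C₁ * ‖c‖ := (norm_nonneg _).trans this
    calc ‖E c‖ ^ 2 ≤ (C₁ * ‖c‖) ^ 2 := pow_le_pow_left₀ (norm_nonneg _) this 2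
      _ = C₁ ^ 2 * ‖c‖ ^ 2 := by ring
  have hs := hslot (E c)
  have hQ : ‖Qk F n K h c₀ cB U₀ (E c)‖ ≤ (1 + θ) * ‖c‖ := by
    calc ‖Qk F n K h c₀ cB U₀ (E c)‖ = ‖(Qk F n K h c₀ cB U₀ (E c) - c) + c‖ := by rw [sub_add_cancel]
      _ ≤ ‖Qk F n K h c₀ cB U₀ (E c) - c‖ + ‖c‖ := norm_add_le _ _
      _ ≤ θ * ‖c‖ + ‖c‖ := by linarith [hQE c]
      _ = (1 + θ) * ‖c‖ := by ring
  have hQ2 : a * ‖Qk F n K h c₀ cB U₀ (E c)‖ ^ 2 ≤ a * ((1 + θ) ^ 2 * ‖c‖ ^ 2) := by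
    refine mul_le_mul_of_nonneg_left ?_ ha
    calc ‖Qk F n K h c₀ cB U₀ (E c)‖ ^ 2 ≤ ((1 + θ) * ‖c‖) ^ 2 := pow_le_pow_left₀ (norm_nonneg _) hQ 2
      _ = (1 + θ) ^ 2 * ‖c‖ ^ 2 := by ring
  have hloc2 : Cloc * ‖E c‖ ^ 2 ≤ Cloc * (C₁ ^ 2 * ‖c‖ ^ 2) := mul_le_mul_of_nonneg_left hv2 hCloc0
  have hs2 : Cs * ‖E c‖ ^ 2 ≤ Cs * (C₁ ^ 2 * ‖c‖ ^ 2) := mul_le_mul_of_nonneg_left hv2 hCs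
  nlinarith

/-! ## §3 The K-free bound of `K⁻¹` on `RegPr` from the interpolant's rows -/

/-- ★★★ **THE BOUND OF `K⁻¹ = (Q_kGQ_k*)⁻¹` FROM AN INTERPOLANT'S ROWS**: on the class (`PosOnto`, `Δx` symmetric), `RegPr F n K ε₀ U₀`, `0 ≤ a`, with the rows of §2 and `θ ≤ ½`:
`‖K⁻¹ω‖ ≤ 4C₀‖ω‖` and `(4C₀)⁻¹‖ω‖² ≤ re⟪ω, Q_kGQ_k†ω⟫`, `C₀ := C_D + (C_loc(ε₀) + C_s)C₁² + a(1+θ)²` — ✓`norm_KinvT_le_of_approxRightInverse` ∘ §2. The `m₀` of the coarse Agmon engine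
for (K2) and the diagonal of print's (3.132). [cite: Balaban1985BackgroundPropagators, (3.132) p.422, (3.126)–(3.127) pp.420–421; Balaban1984PropagatorsI, (1.47)–(1.50) p.26] -/
theorem norm_KinvT_le_of_interpolant_rows (hp : PosOnto F n K h c₀ cB a Δx U₀) (hΔs : (Δx U₀).IsSymmetric) {ε₀ : ℝ} (hε₀ : 0 ≤ ε₀) (hreg : RegPr F n K ε₀ U₀)
    (ha : 0 ≤ a) (E : WL2 ℂ (fun _ : PBond (F.P n) 0 => cB) W₂ →ₗ[ℂ] BondL2K ℂ 3 (periodsT3 F K) c₀ W₂) {θ C₁ CD Cs : ℝ} (hθ : 0 ≤ θ) (hθ2 : θ ≤ 1 / 2)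
    (hCs : 0 ≤ Cs) (hCD : 0 < CD)
    (hQE : ∀ c, ‖Qk F n K h c₀ cB U₀ (E c) - c‖ ≤ θ * ‖c‖)
    (hE₁ : ∀ c, ‖E c‖ ≤ C₁ * ‖c‖)
    (hED : ∀ c, ∑ μ : Fin (F.P K).d, ‖DL2 F n K c₀ U₀ (toL2S F K c₀ (formComp ((toL2 F K c₀).symm (E c)) μ))‖ ^ 2 ≤ CD * ‖c‖ ^ 2)
    (hslot : ∀ v, RCLike.re ⟪v, (Δx U₀ - (DeltaEta F n K c₀ U₀ : BondL2K ℂ 3 (periodsT3 F K) c₀ W₂ →ₗ[ℂ] BondL2K ℂ 3 (periodsT3 F K) c₀ W₂)) v⟫_ℂ ≤ Cs * ‖v‖ ^ 2)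
    (ω : WL2 ℂ (fun _ : PBond (F.P n) 0 => cB) W₂) :
    ‖KinvT F n K h c₀ cB a Δx U₀ ω‖ ≤ 4 * (CD + (32 * Real.sqrt 2 * ε₀ * (((F.P K).d : ℝ) * (2 * 3) ^ (F.P K).d) + Cs) * C₁ ^ 2 + a * (1 + θ) ^ 2) * ‖ω‖
      ∧ (4 * (CD + (32 * Real.sqrt 2 * ε₀ * (((F.P K).d : ℝ) * (2 * 3) ^ (F.P K).d) + Cs) * C₁ ^ 2 + a * (1 + θ) ^ 2))⁻¹ * ‖ω‖ ^ 2
          ≤ RCLike.re ⟪ω, Qk F n K h c₀ cB U₀ (GT F n K h c₀ cB a Δx U₀ (LinearMap.adjoint (Qk F n K h c₀ cB U₀) ω))⟫_ℂ := by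
  have hC₀ : 0 < CD + (32 * Real.sqrt 2 * ε₀ * (((F.P K).d : ℝ) * (2 * 3) ^ (F.P K).d) + Cs) * C₁ ^ 2 + a * (1 + θ) ^ 2 := by positivity
  have hQE' : ∀ c, ‖Qk F n K h c₀ cB U₀ (E c) - c‖ ≤ (1 / 2) * ‖c‖ := fun c =>
    (hQE c).trans (mul_le_mul_of_nonneg_right hθ2 (norm_nonneg _))
  exact norm_KinvT_le_of_approxRightInverse hp hΔs hC₀ E hQE' (energy_interpolant_le hε₀ hreg ha E hCs hQE hE₁ hED hslot) ω

/-- ★★ **THE SLOT OF RECORD `DeltaEtaSlot` (`G₀` of p.421): `C_s = 0`** — `‖KinvT … (DeltaEtaSlot …) U₀ ω‖ ≤ 4(C_D + C_loc(ε₀)C₁² + a(1+θ)²)‖ω‖` and the matching coercivity of `K`.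
[cite: Balaban1985BackgroundPropagators, (3.27) p.395, p.421, (3.132) p.422] -/
theorem norm_KinvT_DeltaEtaSlot_le_of_interpolant_rows (hp : PosOnto F n K h c₀ cB a (DeltaEtaSlot F n K c₀) U₀) {ε₀ : ℝ} (hε₀ : 0 ≤ ε₀) (hreg : RegPr F n K ε₀ U₀)
    (ha : 0 ≤ a) (E : WL2 ℂ (fun _ : PBond (F.P n) 0 => cB) W₂ →ₗ[ℂ] BondL2K ℂ 3 (periodsT3 F K) c₀ W₂) {θ C₁ CD : ℝ} (hθ : 0 ≤ θ) (hθ2 : θ ≤ 1 / 2) (hCD : 0 < CD)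
    (hQE : ∀ c, ‖Qk F n K h c₀ cB U₀ (E c) - c‖ ≤ θ * ‖c‖)
    (hE₁ : ∀ c, ‖E c‖ ≤ C₁ * ‖c‖)
    (hED : ∀ c, ∑ μ : Fin (F.P K).d, ‖DL2 F n K c₀ U₀ (toL2S F K c₀ (formComp ((toL2 F K c₀).symm (E c)) μ))‖ ^ 2 ≤ CD * ‖c‖ ^ 2)
    (ω : WL2 ℂ (fun _ : PBond (F.P n) 0 => cB) W₂) :
    ‖KinvT F n K h c₀ cB a (DeltaEtaSlot F n K c₀) U₀ ω‖ ≤ 4 * (CD + (32 * Real.sqrt 2 * ε₀ * (((F.P K).d : ℝ) * (2 * 3) ^ (F.P K).d) + 0) * C₁ ^ 2 + a * (1 + θ) ^ 2) * ‖ω‖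
      ∧ (4 * (CD + (32 * Real.sqrt 2 * ε₀ * (((F.P K).d : ℝ) * (2 * 3) ^ (F.P K).d) + 0) * C₁ ^ 2 + a * (1 + θ) ^ 2))⁻¹ * ‖ω‖ ^ 2
          ≤ RCLike.re ⟪ω, Qk F n K h c₀ cB U₀ (GT F n K h c₀ cB a (DeltaEtaSlot F n K c₀) U₀ (LinearMap.adjoint (Qk F n K h c₀ cB U₀) ω))⟫_ℂ := by
  have hΔs : (DeltaEtaSlot F n K c₀ U₀).IsSymmetric := Prop7SectET3WilsonHessian.DeltaEta_isSymmetric U₀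
  have hslot : ∀ v : BondL2K ℂ 3 (periodsT3 F K) c₀ W₂,
      RCLike.re ⟪v, (DeltaEtaSlot F n K c₀ U₀ - (DeltaEta F n K c₀ U₀ : BondL2K ℂ 3 (periodsT3 F K) c₀ W₂ →ₗ[ℂ] BondL2K ℂ 3 (periodsT3 F K) c₀ W₂)) v⟫_ℂ
        ≤ 0 * ‖v‖ ^ 2 := fun v => by
    have e : DeltaEtaSlot F n K c₀ U₀ - (DeltaEta F n K c₀ U₀ : BondL2K ℂ 3 (periodsT3 F K) c₀ W₂ →ₗ[ℂ] BondL2K ℂ 3 (periodsT3 F K) c₀ W₂) = 0 := sub_self _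
    rw [e, LinearMap.zero_apply, inner_zero_right, map_zero, zero_mul]
  exact norm_KinvT_le_of_interpolant_rows hp hΔs hε₀ hreg ha E hθ hθ2 le_rfl hCD hQE hE₁ hED hslot ω

end Summit.QuantumFields.YangMills.Theorems.Prop7KinvBoundOfInterpolant

end
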